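import Mathlib.RingTheory.MvPolynomial.EulerIdentity
import Mathlib.Tactic
import Literature.Computability.AlgebraicComplexity.SetMultilinear
import Summits.ValiantsHypothesis.ValiantsHypothesis.Theorems.RowSmlDepthFour
import HarnessLib

/-!
# The leaf-count law for set-multilinear block glues of the permanent
(decomposition workshop `decomp-valiant`, lens 6 «restricted-models lifting axis», gen 3 — the
critic's question w1 answered in the kernel, in the language of the lifting side)

**The shape of every lifting identity of the node** (`Theorems.BlockLaplaceCircuit`, exact-cover and
generalized Laplace expansions): `per_n = G(y)` where the rows are partitioned into blocks
(`β : Fin n → Fin m`), the LEAVES `y (b, ℓ)` are polynomials in the rows of block `b` only, and the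
GLUE `G ∈ F[Y_(b,ℓ)]` is SET-MULTILINEAR in the blocks (every monomial takes exactly one leaf from
every block; `Literature…IsSetMultilinear Prod.fst univ G`).

**What is proved** (`choose_le_card_leaves`): for every block `b₀`, the number of DISTINCT leaves of
block `b₀` is at least `C(n, |β⁻¹ b₀|)`. Proof: by the Euler identity for the block-`b₀` degree
(`G` is weighted-homogeneous of degree `1` for the weight "leaf of block `b₀`"),
`G = Σ_ℓ Y_(b₀,ℓ) · ∂G/∂Y_(b₀,ℓ)`, and each `∂G/∂Y_(b₀,ℓ)` involves no leaf of block `b₀`; evaluating,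
`per_n = Σ_ℓ y(b₀,ℓ) · g_ℓ` with `g_ℓ ∈ F[rows outside block b₀]`, and the block flattening law
`Theorems.RowPartitionRank.choose_le_card_image_of_perPoly_eq_sum_mul_blockLocal` applies.

CONSEQUENCE (the dial is zero-sum along block identities; NODE-v3 §w1): p-bounded leaf families force
every block to have `O(1)` or `n − O(1)` rows, so a size-decreasing block self-reduction with
p-bounded leaves has `Ω(n)` blocks — where the set-multilinearisation loss `4^(#blocks)` of the
lifting side (`Theorems.BlockLaplaceLift`) is `2^Ω(n)`.

HONEST FRAMING: an unconditional structural inequality about identities for the permanent; nothing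
here is evidence for `VP ≠ VNP`, which is NOT proved.

## References
* [NisanWigderson1996] N. Nisan, A. Wigderson, Comput. Complexity 6 (1996/97), §3 (partial
  derivatives / flattenings).
* [LimayeSrinivasanTavenas2025] N. Limaye, S. Srinivasan, S. Tavenas, J. ACM (2025), §2
  (set-multilinear polynomials over a variable partition).
-/

-- layout Summits/ValiantsHypothesis/ValiantsHypothesis forces the duplicated namespace component
set_option linter.dupNamespace false

namespace Summit.ValiantsHypothesis.ValiantsHypothesis.Theorems.GlueLeafCount

open Finset MvPolynomial Literature.Computability.AlgebraicComplexity
open Summit.ValiantsHypothesis.ValiantsHypothesis.Theorems.RowSmlDepthFour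

noncomputable section

section Weights

variable {R : Type*} [CommSemiring R]

/-- The `i`-th entry of the block-degree vector is the scalar weighted degree for the indicator
weight of block `i`. [folklore] -/
theorem weight_blockWeight_apply_eq {σ ι : Type*} [DecidableEq ι] (blk : σ → ι) (d : σ →₀ ℕ)
    (i : ι) :
    (Finsupp.weight (blockWeight blk) d) i = Finsupp.weight (fun v => if blk v = i then 1 else 0) d := by
  rw [Finsupp.weight_apply, Finsupp.weight_apply, Finsupp.sum_apply]
  refine Finsupp.sum_congr fun v _ => ?_
  show (d v • blockWeight blk v) i = d v • (if blk v = i then 1 else 0)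
  rw [blockWeight, Finsupp.smul_apply, Finsupp.single_apply]

/-- A polynomial set-multilinear over all blocks has degree exactly `1` in each block.
[cite: LimayeSrinivasanTavenas2025, §2] -/
theorem isWeightedHomogeneous_block {m : ℕ} {L : Type*} (G : MvPolynomial (Fin m × L) R)
    (hG : IsSetMultilinear Prod.fst (univ : Finset (Fin m)) G) (b₀ : Fin m) :
    IsWeightedHomogeneous (fun v : Fin m × L => if v.1 = b₀ then 1 else 0) G 1 := by
  intro d hd
  have h1 := hG hd
  have h2 : (Finsupp.weight (blockWeight Prod.fst) d) b₀ =
      (blockProfile (univ : Finset (Fin m))) b₀ := congrArg (fun f => f b₀) h1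
  rw [weight_blockWeight_apply_eq, blockProfile_apply, if_pos (mem_univ _)] at h2
  exact h2

/-- Euler identity in one block: `G = Σ_ℓ Y_(b₀,ℓ) · ∂G/∂Y_(b₀,ℓ)` for `G` set-multilinear over all
blocks. [cite: LimayeSrinivasanTavenas2025, §2] -/
theorem eq_sum_X_mul_pderiv {m : ℕ} {L : Type*} [Fintype L] (G : MvPolynomial (Fin m × L) R)
    (hG : IsSetMultilinear Prod.fst (univ : Finset (Fin m)) G) (b₀ : Fin m) :
    G = ∑ ℓ : L, X (b₀, ℓ) * pderiv (b₀, ℓ) G := by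
  have h := (isWeightedHomogeneous_block G hG b₀).sum_weight_X_mul_pderiv
  rw [one_smul] at h
  calc G = ∑ v : Fin m × L, (if v.1 = b₀ then 1 else 0) • (X v * pderiv v G) := h.symm
    _ = ∑ b : Fin m, ∑ ℓ : L, (if b = b₀ then 1 else 0) • (X (b, ℓ) * pderiv (b, ℓ) G) :=
        Fintype.sum_prod_type _
    _ = ∑ ℓ : L, X (b₀, ℓ) * pderiv (b₀, ℓ) G := by
        rw [Finset.sum_eq_single b₀ (fun b _ hb => by simp [hb]) (fun hb => absurd (mem_univ _) hb)]
        simp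

end Weights

section LeafCount

variable {F : Type*} [Field F]

/-- Locality transports to a larger row set. [folklore] -/
theorem isLocal_mono {n : ℕ} {S T : Finset (Fin n)} (hST : S ⊆ T)
    {p : MvPolynomial (Fin n × Fin n) F}
    (hp : ∃ h : MvPolynomial {ij : Fin n × Fin n // ij.1 ∈ S} F, p = rename Subtype.val h) :
    ∃ h : MvPolynomial {ij : Fin n × Fin n // ij.1 ∈ T} F, p = rename Subtype.val h := by
  obtain ⟨h, rfl⟩ := hp
  refine ⟨rename (fun v => (⟨v.1, hST v.2⟩ : {ij : Fin n × Fin n // ij.1 ∈ T})) h, ?_⟩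
  rw [rename_rename]
  rfl

/-- Constants are local. [folklore] -/
theorem isLocal_algebraMap {n : ℕ} {S : Finset (Fin n)} (a : F) :
    ∃ h : MvPolynomial {ij : Fin n × Fin n // ij.1 ∈ S} F,
      algebraMap F (MvPolynomial (Fin n × Fin n) F) a = rename Subtype.val h :=
  ⟨C a, by rw [rename_C, MvPolynomial.algebraMap_eq]⟩

/-- Powers of local polynomials are local. [folklore] -/
theorem isLocal_pow {n : ℕ} {S : Finset (Fin n)} {p : MvPolynomial (Fin n × Fin n) F}
    (hp : ∃ h : MvPolynomial {ij : Fin n × Fin n // ij.1 ∈ S} F, p = rename Subtype.val h) (k : ℕ) :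
    ∃ h : MvPolynomial {ij : Fin n × Fin n // ij.1 ∈ S} F, p ^ k = rename Subtype.val h := by
  obtain ⟨h, rfl⟩ := hp
  exact ⟨h ^ k, (map_pow _ _ _).symm⟩

/-- **The leaf-count law.** If `per_n = G(y)` with a glue `G` set-multilinear in the blocks and
leaves `y (b, ℓ)` local to the rows of block `b`, then block `b₀` has at least `C(n, |block b₀|)`
distinct leaves. The leaf index type `L` is arbitrary (for the node's own identity
`Theorems.BlockLaplaceCircuit.perPoly_eq_aeval_xcPoly` it is `PowC (m*c) c`, and the bound is attained:
`C(mc, c)` leaves per block). [cite: NisanWigderson1996, Thm. 3.2 (method)] -/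
theorem choose_le_card_leaves (n m : ℕ) {L : Type*} [Fintype L] [DecidableEq L]
    (β : Fin n → Fin m) (y : Fin m × L → MvPolynomial (Fin n × Fin n) F)
    (hy : ∀ v, ∃ h : MvPolynomial {ij : Fin n × Fin n // ij.1 ∈ univ.filter (fun i => β i = v.1)} F,
      y v = rename Subtype.val h)
    (G : MvPolynomial (Fin m × L) F)
    (hG : IsSetMultilinear Prod.fst (univ : Finset (Fin m)) G)
    (h : perPoly (Fin n) F = aeval y G) (b₀ : Fin m)
    [DecidableEq (MvPolynomial (Fin n × Fin n) F)] :
    n.choose (univ.filter (fun i => β i = b₀)).card ≤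
      ((univ : Finset L).image (fun ℓ => y (b₀, ℓ))).card := by
  set B₀ : Finset (Fin n) := univ.filter (fun i => β i = b₀) with hB₀
  -- `per = Σ_ℓ y(b₀,ℓ) · (∂G/∂Y_(b₀,ℓ))(y)`
  have hper : perPoly (Fin n) F = ∑ ℓ : L, y (b₀, ℓ) * aeval y (pderiv (b₀, ℓ) G) := by
    rw [h]
    conv_lhs => rw [eq_sum_X_mul_pderiv G hG b₀]
    simp only [map_sum, map_mul, aeval_X]
  -- the leaves of block `b₀` are local to its rows
  have hf : ∀ ℓ : L, ∃ hh : MvPolynomial {ij : Fin n × Fin n // ij.1 ∈ B₀} F,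
      y (b₀, ℓ) = rename Subtype.val hh := fun ℓ => hy (b₀, ℓ)
  -- the derivative factors are local to the other rows
  have hg : ∀ ℓ : L, ∃ hh : MvPolynomial {ij : Fin n × Fin n // ij.1 ∈ B₀ᶜ} F,
      aeval y (pderiv (b₀, ℓ) G) = rename Subtype.val hh := by
    intro ℓ
    -- `∂G/∂Y_(b₀,ℓ)` has degree `0` in block `b₀`
    have hPh : IsWeightedHomogeneous (fun v : Fin m × L => if v.1 = b₀ then 1 else 0)
        (pderiv (b₀, ℓ) G) 0 :=
      (isWeightedHomogeneous_block G hG b₀).pderiv (by simp)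
    -- so no monomial of it touches block `b₀`
    have hdeg : ∀ d ∈ (pderiv (b₀, ℓ) G).support, ∀ v ∈ d.support, v.1 ≠ b₀ := by
      intro d hd v hv hv0
      have h2 := hPh (mem_support_iff.mp hd)
      rw [Finsupp.weight_apply, Finsupp.sum] at h2
      have h3 : d v • (if v.1 = b₀ then 1 else 0) ≤
          ∑ x ∈ d.support, d x • (if x.1 = b₀ then 1 else 0) :=
        Finset.single_le_sum (f := fun x => d x • (if x.1 = b₀ then 1 else 0))
          (fun _ _ => Nat.zero_le _) hv
      rw [h2, if_pos hv0, smul_eq_mul, mul_one] at h3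
      exact (Finsupp.mem_support_iff.mp hv) (Nat.le_zero.mp h3)
    rw [(pderiv (b₀, ℓ) G).as_sum, map_sum]
    refine isLocal_sum _ _ fun d hd => ?_
    rw [aeval_monomial, Finsupp.prod]
    refine isLocal_mul (isLocal_algebraMap _) (isLocal_prod _ _ fun v hv => isLocal_pow ?_ _)
    refine isLocal_mono ?_ (hy v)
    intro i hi
    have hβ : β i = v.1 := (Finset.mem_filter.mp hi).2
    rw [Finset.mem_compl, hB₀, Finset.mem_filter]
    exact fun h' => hdeg d hd v hv (hβ.symm.trans h'.2)
  -- reindex the leaves of block `b₀` by `Fin (card L)` and apply the block flattening law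
  set e := Fintype.equivFin L with he
  have hper' : perPoly (Fin n) F =
      ∑ t : Fin (Fintype.card L), y (b₀, e.symm t) * aeval y (pderiv (b₀, e.symm t) G) := by
    rw [hper]; exact (Equiv.sum_comp e.symm (fun ℓ => y (b₀, ℓ) * aeval y (pderiv (b₀, ℓ) G))).symm
  have himg : ((univ : Finset (Fin (Fintype.card L))).image (fun t => y (b₀, e.symm t))) =
      (univ : Finset L).image (fun ℓ => y (b₀, ℓ)) := by
    ext p
    simp only [Finset.mem_image, Finset.mem_univ, true_and]
    constructor
    · rintro ⟨t, ht⟩; exact ⟨e.symm t, ht⟩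
    · rintro ⟨ℓ, hℓ⟩; exact ⟨e ℓ, by rw [Equiv.symm_apply_apply]; exact hℓ⟩
  rw [← himg]
  exact RowPartitionRank.choose_le_card_image_of_perPoly_eq_sum_mul_blockLocal n (Fintype.card L) B₀
    (fun t => y (b₀, e.symm t)) (fun t => aeval y (pderiv (b₀, e.symm t) G))
    (fun t => hf _) (fun t => hg _) hper'

/-- Corollary: block `b₀` has at least `C(n, |block b₀|)` leaf slots (`|L| ≥ C(n,|B_b₀|)`).
[cite: NisanWigderson1996, Thm. 3.2 (method)] -/
theorem choose_le_leaves (n m : ℕ) {L : Type*} [Fintype L] (β : Fin n → Fin m)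
    (y : Fin m × L → MvPolynomial (Fin n × Fin n) F)
    (hy : ∀ v, ∃ h : MvPolynomial {ij : Fin n × Fin n // ij.1 ∈ univ.filter (fun i => β i = v.1)} F,
      y v = rename Subtype.val h)
    (G : MvPolynomial (Fin m × L) F)
    (hG : IsSetMultilinear Prod.fst (univ : Finset (Fin m)) G)
    (h : perPoly (Fin n) F = aeval y G) (b₀ : Fin m) :
    n.choose (univ.filter (fun i => β i = b₀)).card ≤ Fintype.card L := by
  classical
  exact (choose_le_card_leaves n m β y hy G hG h b₀).trans (card_image_le.trans (by simp))

end LeafCount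

end

end Summit.ValiantsHypothesis.ValiantsHypothesis.Theorems.GlueLeafCount
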